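import Mathlib
import Summits.ValiantsHypothesis.ValiantsHypothesis.Theorems.NewtonFramesNewtonTauWeakBlockConvexThree

/-!
# Crux `NewtonTauWeak` (stmt-ValiantsHypothesis-5904), line `slope-ladder`: `M_5(N) ≥ (N/21)^3` by Lagrange interpolation

STUB 1 of `Cruxes/NewtonTauWeak/Lines/slope_ladder.lean` (`stub_blockConvexBound`) asks for a block count `r` and a
`δ > 0` with `M_r(N) ≤ C (N+2)^{(2/3-δ) r}`, where `M_r(N)` is the largest convexly independent subset of an `r`-fold
Minkowski sum of planar `N`-sets.  The only lower bounds in print are `M_2(N) = Θ(N^{4/3})` [BBFKOTT10] and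
`M_r(N) ≥ N^{r/3} - 1` [KoiranPortierTavenasThomasse2015, Prop. 1]; the companion file `…BlockConvexThree` adds
`M_3(N) = Θ(N²)`.  This file proves the first instance `k = 3` of a new family

  `M_{2k-1}(C_k n) ≥ n^k`      (LAGRANGE MECHANISM),

namely `five_sets_parabola : M_5(21 n) ≥ n³`, so the exponent of `M_5` is `≥ 3` (was `≥ 2`), and
`blockConvexBound_five_exponent`: no bound `C (N+2)^e` with `e < 3` holds for five summands (a witness of the stub with
`r = 5` needs `δ ≤ 1/15`).

MECHANISM.  Index points by `t = (t₀,t₁,t₂) ∈ [n]³`, i.e. by the polynomial `P_t(X) = t₀ + t₁X + t₂X²`, and put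
`s(t) = (P_t(n), P_t(n)²)` — `n³` distinct points (base-`n` digits) on the parabola `y = x²`, hence convexly independent
(`parabola_convexIndependent`).  Since `deg P_t² ≤ 4`, Lagrange interpolation at the five nodes `0,1,2,3,4` gives
`P_t(n)^j = Σ_ℓ L_ℓ(n) P_t(ℓ)^j` for `j = 1, 2`, i.e. `s(t) = Σ_{ℓ<5} L_ℓ(n)·(P_t(ℓ), P_t(ℓ)²)`, and the `ℓ`-th summand
ranges over the set `P_ℓ = {L_ℓ(n)(v, v²) : v < (1+ℓ+ℓ²) n}` of `≤ 21 n` points because `P_t(ℓ) = t₀ + ℓt₁ + ℓ²t₂` takes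
few values on the box.  (General `k`: nodes `0,…,2k-2`, `deg P_t² = 2k-2`, `2k-1` summands of size `O_k(n)`, `n^k`
points; per-summand exponent `k/(2k-1) ↓ 1/2`.  So block convexity can never certify a slope below `1/2`: KPTT's
ceiling `1/3` for this method family rises to `1/2`; the typed rung `SlopeThird` is out of its reach.)

Helper for the crux item (`--supports`); the stub itself (some `r` beats `2/3`) stays OPEN; nothing here bears on
`NewtonTauWeak` or `VP ≠ VNP`.
-/

set_option linter.dupNamespace false

namespace Summit.ValiantsHypothesis.ValiantsHypothesis.Theorems.NewtonFramesNewtonTauWeak.BlockConvexFive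

open scoped BigOperators Pointwise
open Summit.ValiantsHypothesis.ValiantsHypothesis.Theorems.NewtonFramesNewtonTauWeak.BlockConvexThree
  (vec2_add parabola_convexIndependent)

noncomputable section

/-- Base-`n` injectivity: `t₀ + n t₁ + n² t₂` determines `(t₀, t₁, t₂) ∈ [n]³`. [folklore] -/
theorem base_injective {n t₀ t₁ t₂ s₀ s₁ s₂ : ℕ} (h₀ : t₀ < n) (h₁ : t₁ < n) (g₀ : s₀ < n) (g₁ : s₁ < n)
    (h : t₀ + n * t₁ + n * n * t₂ = s₀ + n * s₁ + n * n * s₂) : t₀ = s₀ ∧ t₁ = s₁ ∧ t₂ = s₂ := by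
  have hn : 0 < n := by omega
  have e1 : (t₀ + n * (t₁ + n * t₂)) % n = t₀ := by rw [Nat.add_mul_mod_self_left, Nat.mod_eq_of_lt h₀]
  have e2 : (s₀ + n * (s₁ + n * s₂)) % n = s₀ := by rw [Nat.add_mul_mod_self_left, Nat.mod_eq_of_lt g₀]
  have h' : t₀ + n * (t₁ + n * t₂) = s₀ + n * (s₁ + n * s₂) := by
    have : t₀ + n * t₁ + n * n * t₂ = t₀ + n * (t₁ + n * t₂) := by ring
    have : s₀ + n * s₁ + n * n * s₂ = s₀ + n * (s₁ + n * s₂) := by ring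
    omega
  have ht₀ : t₀ = s₀ := by rw [← e1, ← e2, h']
  subst ht₀
  have h2 : n * (t₁ + n * t₂) = n * (s₁ + n * s₂) := by omega
  have h3 : t₁ + n * t₂ = s₁ + n * s₂ := Nat.eq_of_mul_eq_mul_left hn h2
  have e3 : (t₁ + n * t₂) % n = t₁ := by rw [Nat.add_mul_mod_self_left, Nat.mod_eq_of_lt h₁]
  have e4 : (s₁ + n * s₂) % n = s₁ := by rw [Nat.add_mul_mod_self_left, Nat.mod_eq_of_lt g₁]
  have ht₁ : t₁ = s₁ := by rw [← e3, ← e4, h3]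
  subst ht₁
  have h4 : n * t₂ = n * s₂ := by omega
  exact ⟨rfl, rfl, Nat.eq_of_mul_eq_mul_left hn h4⟩

/-- No polynomial bound of exponent `e < k`: if `n^k ≤ C (K n + 2)^e` for all `n` (with `K ≥ 1`), contradiction.
(For `e ≥ 0`: `(Kn+2)^e ≤ ((K+2)n)^e`, so `n^{k-e} ≤ C (K+2)^e`, absurd as `n → ∞`; for `e < 0`: `n^k ≤ C`.) [folklore] -/
theorem no_power_bound (k : ℕ) (hk : 1 ≤ k) (K e C : ℝ) (hK : 1 ≤ K) (he : e < k)
    (h : ∀ n : ℕ, ((n : ℝ) ^ k) ≤ C * (K * n + 2) ^ e) : False := by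
  have hK2 : (0 : ℝ) < (K + 2) ^ e := Real.rpow_pos_of_pos (by linarith) _
  -- `0 ≤ C` from `n = 1`
  have hC : 0 ≤ C := by
    have h1 := h 1
    simp only [Nat.cast_one, one_pow, mul_one] at h1
    by_contra hC'
    push Not at hC'
    have : C * (K + 2) ^ e < 0 := mul_neg_of_neg_of_pos hC' hK2
    linarith
  by_cases he0 : 0 ≤ e
  · have hke : 0 < (k : ℝ) - e := by linarith
    have hev : ∀ᶠ n : ℕ in Filter.atTop, C * (K + 2) ^ e < (n : ℝ) ^ ((k : ℝ) - e) :=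
      ((tendsto_rpow_atTop hke).comp tendsto_natCast_atTop_atTop).eventually_gt_atTop _
    obtain ⟨n, hn, hn1⟩ := (hev.and (Filter.eventually_ge_atTop 1)).exists
    have hn1' : (1 : ℝ) ≤ n := by exact_mod_cast hn1
    have hnpos : (0 : ℝ) < n := by linarith
    have hb := h n
    have hKn : K * n + 2 ≤ (K + 2) * (n : ℝ) := by nlinarith
    have hKn0 : (0 : ℝ) ≤ K * n + 2 := by positivity
    have hpow : (K * n + 2) ^ e ≤ ((K + 2) * (n : ℝ)) ^ e := Real.rpow_le_rpow hKn0 hKn he0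
    have hmul : ((K + 2) * (n : ℝ)) ^ e = (K + 2) ^ e * (n : ℝ) ^ e := Real.mul_rpow (by linarith) hnpos.le
    have hsplit : (n : ℝ) ^ (k : ℝ) = (n : ℝ) ^ e * (n : ℝ) ^ ((k : ℝ) - e) := by
      rw [← Real.rpow_add hnpos]; ring_nf
    have hnk : ((n : ℝ) ^ k : ℝ) = (n : ℝ) ^ (k : ℝ) := by norm_cast
    have hmain : (n : ℝ) ^ e * (n : ℝ) ^ ((k : ℝ) - e) ≤ (n : ℝ) ^ e * (C * (K + 2) ^ e) := by
      calc (n : ℝ) ^ e * (n : ℝ) ^ ((k : ℝ) - e) = (n : ℝ) ^ k := by rw [hnk, hsplit]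
        _ ≤ C * (K * n + 2) ^ e := hb
        _ ≤ C * ((K + 2) ^ e * (n : ℝ) ^ e) := by rw [← hmul]; exact mul_le_mul_of_nonneg_left hpow hC
        _ = (n : ℝ) ^ e * (C * (K + 2) ^ e) := by ring
    have hne_pos : (0 : ℝ) < (n : ℝ) ^ e := Real.rpow_pos_of_pos hnpos _
    have := le_of_mul_le_mul_left hmain hne_pos
    linarith
  · push Not at he0
    obtain ⟨m, hm⟩ := exists_nat_gt C
    have hbm := h (m + 1)
    have hm1 : (1 : ℝ) ≤ ((m + 1 : ℕ) : ℝ) := by exact_mod_cast Nat.succ_pos m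
    have hpowm : (K * ((m + 1 : ℕ) : ℝ) + 2) ^ e ≤ 1 :=
      Real.rpow_le_one_of_one_le_of_nonpos (by nlinarith) he0.le
    have hsqm : (((m + 1 : ℕ) : ℝ)) ^ k ≤ C := by
      calc (((m + 1 : ℕ) : ℝ)) ^ k ≤ C * (K * ((m + 1 : ℕ) : ℝ) + 2) ^ e := hbm
        _ ≤ C * 1 := mul_le_mul_of_nonneg_left hpowm hC
        _ = C := mul_one C
    have hle : (((m + 1 : ℕ) : ℝ)) ≤ (((m + 1 : ℕ) : ℝ)) ^ k := le_self_pow₀ hm1 (by omega)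
    have hmm : (m : ℝ) < ((m + 1 : ℕ) : ℝ) := by push_cast; linarith
    linarith

/-- **`M_5(21 n) ≥ n³` (Lagrange mechanism, `k = 3`).** For every `n` there are five planar sets of at most `21 n`
points each and `n³` points of their Minkowski sum in convex position, all on the parabola `y = x²`:
`P_ℓ = {L_ℓ(n)·(v, v²) : v < (1+ℓ+ℓ²) n}` (`ℓ = 0,…,4`, `L_ℓ` the Lagrange basis at nodes `0,…,4` evaluated at `n`)
and `S = {(P_t(n), P_t(n)²) : t ∈ [n]³}`, `P_t = t₀ + t₁X + t₂X²`.  Improves the known `M_5(N) ≥ max(N², N^{5/3})`.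
[this file] -/
theorem five_sets_parabola (n : ℕ) :
    ∃ (P : Fin 5 → Finset (Fin 2 → ℝ)) (S : Finset (Fin 2 → ℝ)),
      (∀ i, (P i).card ≤ 21 * n) ∧ S ⊆ ∑ i, P i ∧
        ConvexIndependent ℝ (Subtype.val : ↥(S : Set (Fin 2 → ℝ)) → (Fin 2 → ℝ)) ∧ S.card = n ^ 3 := by
  classical
  -- Lagrange basis at nodes 0..4, evaluated at `n`
  set x : ℝ := (n : ℝ) with hx
  set L0 : ℝ := (x - 1) * (x - 2) * (x - 3) * (x - 4) / 24 with hL0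
  set L1 : ℝ := -(x * (x - 2) * (x - 3) * (x - 4)) / 6 with hL1
  set L2 : ℝ := x * (x - 1) * (x - 3) * (x - 4) / 4 with hL2
  set L3 : ℝ := -(x * (x - 1) * (x - 2) * (x - 4)) / 6 with hL3
  set L4 : ℝ := x * (x - 1) * (x - 2) * (x - 3) / 24 with hL4
  -- the summands: scaled parabola points over the values of `P_t(ℓ)`
  set Q : ℝ → ℕ → Finset (Fin 2 → ℝ) := fun L B =>
    (Finset.range B).image fun v : ℕ => (![L * (v : ℝ), L * ((v : ℝ) ^ 2)] : Fin 2 → ℝ) with hQ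
  set P : Fin 5 → Finset (Fin 2 → ℝ) :=
    ![Q L0 (1 * n), Q L1 (3 * n), Q L2 (7 * n), Q L3 (13 * n), Q L4 (21 * n)] with hP
  set S : Finset (Fin 2 → ℝ) :=
    ((Finset.range n ×ˢ Finset.range n) ×ˢ Finset.range n).image fun t =>
      (![((t.1.1 : ℝ) + x * t.1.2 + x ^ 2 * t.2), ((t.1.1 : ℝ) + x * t.1.2 + x ^ 2 * t.2) ^ 2] : Fin 2 → ℝ)
    with hS
  have hQcard : ∀ (L : ℝ) (B : ℕ), (Q L B).card ≤ B := fun L B =>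
    Finset.card_image_le.trans (by simp)
  refine ⟨P, S, ?_, ?_, ?_, ?_⟩
  · intro i
    fin_cases i
    · exact (hQcard L0 (1 * n)).trans (by omega)
    · exact (hQcard L1 (3 * n)).trans (by omega)
    · exact (hQcard L2 (7 * n)).trans (by omega)
    · exact (hQcard L3 (13 * n)).trans (by omega)
    · exact hQcard L4 (21 * n)
  · -- S ⊆ Σ P_ℓ : Lagrange interpolation of `P_t` and `P_t²` at the nodes 0..4
    rw [Fin.sum_univ_five]
    intro s hs
    obtain ⟨⟨⟨t₀, t₁⟩, t₂⟩, ht, rfl⟩ := Finset.mem_image.1 hs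
    simp only [Finset.mem_product, Finset.mem_range] at ht
    obtain ⟨⟨h₀, h₁⟩, h₂⟩ := ht
    -- the value of `P_t` at node `ℓ` and its membership
    have hmem : ∀ (L : ℝ) (ℓ B : ℕ), t₀ + ℓ * t₁ + ℓ * ℓ * t₂ < B →
        (![L * ((t₀ : ℝ) + ℓ * t₁ + ℓ * ℓ * t₂), L * (((t₀ : ℝ) + ℓ * t₁ + ℓ * ℓ * t₂) ^ 2)] : Fin 2 → ℝ)
          ∈ Q L B := by
      intro L ℓ B hB
      refine Finset.mem_image.2 ⟨t₀ + ℓ * t₁ + ℓ * ℓ * t₂, Finset.mem_range.2 hB, ?_⟩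
      push_cast
      rfl
    have m0 := hmem L0 0 (1 * n) (by nlinarith)
    have m1 := hmem L1 1 (3 * n) (by nlinarith)
    have m2 := hmem L2 2 (7 * n) (by nlinarith)
    have m3 := hmem L3 3 (13 * n) (by nlinarith)
    have m4 := hmem L4 4 (21 * n) (by nlinarith)
    have e0 : P 0 = Q L0 (1 * n) := rfl
    have e1 : P 1 = Q L1 (3 * n) := rfl
    have e2 : P 2 = Q L2 (7 * n) := rfl
    have e3 : P 3 = Q L3 (13 * n) := rfl
    have e4 : P 4 = Q L4 (21 * n) := rfl
    rw [e0, e1, e2, e3, e4]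
    refine Finset.mem_add.2 ⟨_, Finset.mem_add.2 ⟨_, Finset.mem_add.2 ⟨_, Finset.mem_add.2
      ⟨_, m0, _, m1, rfl⟩, _, m2, rfl⟩, _, m3, rfl⟩, _, m4, ?_⟩
    rw [vec2_add, vec2_add, vec2_add, vec2_add]
    push_cast
    congr 1
    · simp only [hL0, hL1, hL2, hL3, hL4]; ring
    · funext i
      fin_cases i
      simp only [hL0, hL1, hL2, hL3, hL4, Matrix.cons_val_fin_one]
      ring
  · -- on the parabola
    refine parabola_convexIndependent _ fun s hs => ?_
    obtain ⟨t, -, rfl⟩ := Finset.mem_image.1 (Finset.mem_coe.1 hs)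
    simp
  · -- |S| = n³ : base-n digits
    rw [hS, Finset.card_image_of_injOn, Finset.card_product, Finset.card_product, Finset.card_range]
    · ring
    rintro ⟨⟨t₀, t₁⟩, t₂⟩ ht ⟨⟨s₀, s₁⟩, s₂⟩ hs h
    simp only [Finset.coe_product, Set.mem_prod, Finset.mem_coe, Finset.mem_range] at ht hs
    have h0 : ((t₀ : ℝ) + x * t₁ + x ^ 2 * t₂) = (s₀ : ℝ) + x * s₁ + x ^ 2 * s₂ := by
      simpa using congrFun h 0
    have hnat : t₀ + n * t₁ + n * n * t₂ = s₀ + n * s₁ + n * n * s₂ := by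
      rw [hx] at h0
      exact_mod_cast (by linarith : ((t₀ : ℝ) + n * t₁ + n * n * t₂) = (s₀ : ℝ) + n * s₁ + n * n * s₂)
    obtain ⟨rfl, rfl, rfl⟩ := base_injective ht.1.1 ht.1.2 hs.1.1 hs.1.2 hnat
    rfl

/-- **The exponent of `M_5` is at least `3`**: no `C`, `e < 3` give `#S ≤ C (N+2)^e` for convexly independent
subsets of five-fold Minkowski sums of planar `N`-sets.  In particular a witness `(r, δ, C)` of
`stub_blockConvexBound` with `r = 5` must have `(2/3 - δ)·5 ≥ 3`, i.e. `δ ≤ 1/15`; and for the line's ladder: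
five-block convexity certifies no slope below `3/5`. [this file] -/
theorem blockConvexBound_five_exponent (C e : ℝ) (he : e < 3) :
    ¬ ∀ (N : ℕ) (P : Fin 5 → Finset (Fin 2 → ℝ)) (S : Finset (Fin 2 → ℝ)),
        (∀ i, (P i).card ≤ N) → S ⊆ ∑ i, P i →
          ConvexIndependent ℝ (Subtype.val : ↥(S : Set (Fin 2 → ℝ)) → (Fin 2 → ℝ)) →
            (S.card : ℝ) ≤ C * ((N : ℝ) + 2) ^ e := by
  intro H
  refine no_power_bound 3 (by norm_num) 21 e C (by norm_num) (by exact_mod_cast he) fun n => ?_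
  obtain ⟨P, S, hP, hS, hci, hcard⟩ := five_sets_parabola n
  have := H (21 * n) P S hP hS hci
  rw [hcard] at this
  exact_mod_cast this

/-- The `r = 5` slice of STUB 1 in its own normal form: any `δ > 0` that works with `r = 5` satisfies `δ ≤ 1/15`
(contrapositive of `blockConvexBound_five_exponent` with `e = (2/3 - δ)·5`). [this file] -/
theorem blockConvexBound_five_delta_le (δ C : ℝ)
    (H : ∀ (N : ℕ) (P : Fin 5 → Finset (Fin 2 → ℝ)) (S : Finset (Fin 2 → ℝ)),
        (∀ i, (P i).card ≤ N) → S ⊆ ∑ i, P i →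
          ConvexIndependent ℝ (Subtype.val : ↥(S : Set (Fin 2 → ℝ)) → (Fin 2 → ℝ)) →
            (S.card : ℝ) ≤ C * ((N : ℝ) + 2) ^ ((2 / 3 - δ) * ((5 : ℕ) : ℝ))) :
    δ ≤ 1 / 15 := by
  by_contra hδ
  push Not at hδ
  exact blockConvexBound_five_exponent C ((2 / 3 - δ) * ((5 : ℕ) : ℝ)) (by push_cast; linarith) H

end

end Summit.ValiantsHypothesis.ValiantsHypothesis.Theorems.NewtonFramesNewtonTauWeak.BlockConvexFive
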